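import Summits.CriticalPhenomena.CardyFormulaZ2.Theorems.CardyUSTContinuationKirchhoffExtremalLengthG02Dual3
import Summits.CriticalPhenomena.CardyFormulaZ2.Theorems.CardyUSTContinuationKirchhoffExtremalLengthG02Dual5
import Mathlib.Analysis.Convex.PathConnected
import Literature.Probability.Percolation.TriCollarLocalConn

/-!
# Flux-free walks of squares between two exits of the face component near a boundary point
# (G02 discretisation: exterior paths with short end segments)

Support file for `KirchhoffExtremalLength` (route CardyUSTContinuation of `CardyFormulaZ2`, item
stmt-CriticalPhenomena-11234), towards the upper half of `G02ModulusConvergence` (`…Defs.lean`):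
the device replacing the boundary-arc shadows of the tree's `SquareTilingConjugate.lean` §D5 for
`Ω_δ = discreteDomainGraph Ω δ`.

* `exists_end_data`: the outer square `p'` of an exit `(p, p')` contains a point `f ∈ ∂Ω` on a
  missing side, with a radius `η > 0` such that every lattice side passing within `η` of `f` is
  NOT an edge of `Ω_δ` (`exists_missing_side`, `side_near_point_of_side`);
* `exists_fluxFree_walk`: two exits whose outer squares are near boundary points `qa`, `qb` are
  joined by a walk of squares carrying no flux and staying in a prescribed region: the shadow
  (`SquareTiling.exists_dualWalk_of_path`)
  of the path "segment from `f₁` to a nearby exterior point `e₁`, an exterior path from `e₁` to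
  `e₂` (uniform local connectedness of the exterior, a hypothesis here), segment from `e₂` to
  `f₂`"; steps cross sides at exterior points (non-edges) or within `ηᵢ` of `fᵢ` (non-edges).
-/

noncomputable section

namespace Summit.CriticalPhenomena.CardyFormulaZ2.Theorems

namespace KirchhoffSlope

open Set Metric Filter Topology SimpleGraph
open Literature.Probability Literature.Probability.LatticeModels Literature.Probability.Percolation
open Literature.Probability.LatticeModels.SquareTiling (stepFlux walkFlux closedSq sideSeg
  exists_dualWalk_of_path dist_le_of_mem_closedSq)
open Literature.Probability.RandomPlanarGeometry

variable {δ : ℝ}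

/-- **End data of an exit.** For an exit `(p, p')` of `Ω_δ` (an inner face `p` and a non-inner
lattice neighbour `p'`) there are a boundary point `f` in the closed square `p'` and `η > 0`,
`2η ≤ δ`, such that no lattice side passing within `η` of `f` is an edge of `Ω_δ`: `f` lies on a
missing side `[δu, δ(u+eᵢ)]` of `p'` with an end in `Ω_δ`; a side near `f` is that side, or has
as an end an end `x` of it with `dist f x < η`, forcing `f = x ∈ ∂Ω`, so that `x` is not a mesh
vertex. [folklore] -/
theorem exists_end_data (R : ConformalRectangle) (hδ : 0 < δ) {p p' : Site 2}
    (hp : IsInnerFace R.carrier δ p) (hpp' : (zdGraph 2).Adj p p') (hp' : ¬ IsInnerFace R.carrier δ p') :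
    ∃ (f : ℂ) (η : ℝ), f ∈ frontier R.carrier ∧ f ∈ closedSq δ p' ∧ 0 < η ∧ 2 * η ≤ δ ∧
      ∀ (c : Site 2) (j : Fin 2) (x : ℂ), x ∈ segment ℝ (meshPoint δ c) (meshPoint δ (c + Pi.single j 1)) →
        dist f x < η → ¬ (discreteDomainGraph R.carrier δ).Adj c (c + Pi.single j 1) := by
  set Ω := R.carrier with hΩ
  obtain ⟨u, i, hn, hm, hside⟩ := exists_missing_side hδ.le hp' (exists_corner_mem_meshDomain_of_adj hp hpp')
  have hadj : (zdGraph 2).Adj u (u + Pi.single i 1) := zdGraph_adj_add_single u i (Or.inl rfl)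
  -- a boundary point on the missing side
  obtain ⟨f, hfseg, hff⟩ : ∃ f ∈ segment ℝ (meshPoint δ u) (meshPoint δ (u + Pi.single i 1)), f ∈ frontier Ω := by
    rcases hm with hm | hm
    · exact exists_mem_frontier_of_not_discreteDomainGraph_adj R.toJordanDomain hm hadj hn
    · obtain ⟨f, hf, hff⟩ := exists_mem_frontier_of_not_discreteDomainGraph_adj R.toJordanDomain hm hadj.symm
        (fun h => hn h.symm)
      exact ⟨f, by rwa [segment_symm], hff⟩
  -- boundary points are not mesh points of mesh vertices
  have hfrv : ∀ x : Site 2, f = meshPoint δ x → x ∉ meshVertices Ω δ := by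
    rintro x rfl hx
    exact (R.disjoint_carrier_frontier.ne_of_mem hx hff) rfl
  -- the radius
  set g : ℂ → ℝ := fun x => if f = x then δ else dist f x / 2 with hg
  have hgpos : ∀ x, 0 < g x := fun x => by
    simp only [hg]; split_ifs with h
    · exact hδ
    · exact half_pos (dist_pos.2 h)
  have hgprop : ∀ x, f = x ∨ 2 * g x ≤ dist f x := fun x => by
    simp only [hg]; split_ifs with h
    · exact Or.inl h
    · exact Or.inr (by linarith)
  set η : ℝ := min (δ / 2) (min (g (meshPoint δ u)) (g (meshPoint δ (u + Pi.single i 1)))) with hη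
  have hη0 : 0 < η := lt_min (by positivity) (lt_min (hgpos _) (hgpos _))
  have hη2 : 2 * η ≤ δ := by have := min_le_left (δ / 2) (min (g (meshPoint δ u)) (g (meshPoint δ (u + Pi.single i 1)))); linarith
  have hηu : η ≤ g (meshPoint δ u) := (min_le_right _ _).trans (min_le_left _ _)
  have hηu' : η ≤ g (meshPoint δ (u + Pi.single i 1)) := (min_le_right _ _).trans (min_le_right _ _)
  refine ⟨f, η, hff, hside hfseg, hη0, hη2, fun c j x hx hfx => ?_⟩
  rcases side_near_point_of_side hδ hη2 hfseg hx hfx with ⟨rfl, rfl⟩ | ⟨hd, hcu⟩ | ⟨hd, hcu⟩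
  · exact hn
  · -- `dist f (δu) < η ≤ g(δu)` forces `f = δu`
    have hfu : f = meshPoint δ u := by
      rcases hgprop (meshPoint δ u) with h | h
      · exact h
      · exfalso; linarith
    have hu := hfrv u hfu
    refine not_adj_of_not_mem_meshVertices ?_
    rcases hcu with rfl | h
    · exact Or.inl hu
    · exact Or.inr (h ▸ hu)
  · have hfu : f = meshPoint δ (u + Pi.single i 1) := by
      rcases hgprop (meshPoint δ (u + Pi.single i 1)) with h | h
      · exact h
      · exfalso; linarith
    have hu := hfrv _ hfu
    refine not_adj_of_not_mem_meshVertices ?_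
    rcases hcu with rfl | h
    · exact Or.inl hu
    · exact Or.inr (h ▸ hu)

/-- `sepHi = sepLo + eⱼ` with `j = 0` iff the two squares are in the same column (the crossed
side is horizontal). [folklore] -/
theorem sepHi_eq_sepLo_add (x y : Site 2) :
    sepHi x y = sepLo x y + Pi.single (if x 0 = y 0 then 0 else 1) 1 := rfl

/-- **Flux-free connection of two exits near boundary points.** Let `(p, p')` and `(q₁, q₁')`
be exits of `Ω_δ` whose outer squares have points within `r` of `qa` and of `qb` respectively,
and assume that exterior points within `r + 3δ` of `qa`, resp. `qb`, are joined by exterior paths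
inside a set `S` (near one boundary point, uniform local connectedness of the exterior of the
Jordan domain supplies this with `S` a small ball; for the crosscut loop, `S` also contains the
exterior closing curves). Then `p'` and `q₁'` are joined by a walk of squares carrying no flux (for
the current of any `h`), each of whose squares has a point in `S` or within `r + 3δ` of `qa` or
of `qb`. [folklore] -/
theorem exists_fluxFree_walk (R : ConformalRectangle) (hδ : 0 < δ) (h : Site 2 → ℝ)
    {qa qb : ℂ} {r : ℝ} {S : Set ℂ}
    (hmid : ∀ e₁ e₂ : ℂ, e₁ ∈ (closure R.carrier)ᶜ → e₂ ∈ (closure R.carrier)ᶜ →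
      dist e₁ qa < r + 3 * δ → dist e₂ qb < r + 3 * δ → JoinedIn ((closure R.carrier)ᶜ ∩ S) e₁ e₂)
    {p p' q₁ q₁' : Site 2} (hp : IsInnerFace R.carrier δ p) (hpp' : (zdGraph 2).Adj p p')
    (hp' : ¬ IsInnerFace R.carrier δ p') (hq₁ : IsInnerFace R.carrier δ q₁) (hqq' : (zdGraph 2).Adj q₁ q₁')
    (hq₁' : ¬ IsInnerFace R.carrier δ q₁')
    (hnp : ∃ w ∈ closedSq δ p', dist w qa < r) (hnq : ∃ w ∈ closedSq δ q₁', dist w qb < r) :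
    ∃ ω : (zdGraph 2).Walk p' q₁', walkFlux (ecurH R.carrier δ h) (ecurV R.carrier δ h) ω = 0 ∧
      ∀ Q ∈ ω.support, ∃ w ∈ closedSq δ Q, w ∈ S ∨ dist w qa < r + 3 * δ ∨ dist w qb < r + 3 * δ := by
  set Ω := R.carrier with hΩ
  -- end data
  obtain ⟨f₁, η₁, hf₁, hf₁sq, hη₁, hη₁2, hend₁⟩ := exists_end_data R hδ hp hpp' hp'
  obtain ⟨f₂, η₂, hf₂, hf₂sq, hη₂, hη₂2, hend₂⟩ := exists_end_data R hδ hq₁ hqq' hq₁'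
  -- exterior points near the ends
  obtain ⟨e₁, he₁, hfe₁⟩ := Metric.mem_closure_iff.1 (R.frontier_subset_closure_exterior' hf₁) η₁ hη₁
  obtain ⟨e₂, he₂, hfe₂⟩ := Metric.mem_closure_iff.1 (R.frontier_subset_closure_exterior' hf₂) η₂ hη₂
  -- distances to `q`
  obtain ⟨w₁, hw₁, hw₁q⟩ := hnp
  obtain ⟨w₂, hw₂, hw₂q⟩ := hnq
  have hf₁q : dist f₁ qa ≤ r + 2 * δ := by
    linarith [dist_triangle f₁ w₁ qa, dist_le_of_mem_closedSq hf₁sq hw₁]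
  have hf₂q : dist f₂ qb ≤ r + 2 * δ := by
    linarith [dist_triangle f₂ w₂ qb, dist_le_of_mem_closedSq hf₂sq hw₂]
  have he₁q : dist e₁ qa < r + 3 * δ := by
    linarith [dist_triangle e₁ f₁ qa, _root_.dist_comm e₁ f₁]
  have he₂q : dist e₂ qb < r + 3 * δ := by
    linarith [dist_triangle e₂ f₂ qb, _root_.dist_comm e₂ f₂]
  -- the exterior path and the full path `f₁ → e₁ → e₂ → f₂`
  have hj : JoinedIn ((closure Ω)ᶜ ∩ S) e₁ e₂ := hmid e₁ e₂ he₁ he₂ he₁q he₂q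
  set γ : Path e₁ e₂ := hj.somePath with hγ
  have hγmem : ∀ t, γ t ∈ (closure Ω)ᶜ ∩ S := fun t => hj.somePath_mem t
  set Γ : Path f₁ f₂ := (Path.segment f₁ e₁).trans (γ.trans (Path.segment e₂ f₂)) with hΓ
  have hΓrange : ∀ t : ℝ, Γ.extend t ∈ segment ℝ f₁ e₁ ∨ Γ.extend t ∈ range γ ∨ Γ.extend t ∈ segment ℝ e₂ f₂ := by
    intro t
    have : Γ.extend t ∈ range Γ := by rw [← Path.extend_range]; exact mem_range_self t
    rw [hΓ, Path.trans_range, Path.trans_range, Path.range_segment, Path.range_segment] at this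
    rcases this with h1 | h2 | h3
    · exact Or.inl h1
    · exact Or.inr (Or.inl h2)
    · exact Or.inr (Or.inr h3)
  have hΓc : ContinuousOn (fun t : ℝ => Γ.extend t) (Icc 0 1) := Γ.continuous_extend.continuousOn
  have hΓ0 : Γ.extend 0 ∈ closedSq δ p' := by rw [Path.extend_zero]; exact hf₁sq
  have hΓ1 : Γ.extend 1 ∈ closedSq δ q₁' := by rw [Path.extend_one]; exact hf₂sq
  -- the justified shadow
  obtain ⟨ω, hωd, hωs⟩ := exists_dualWalk_of_path hδ zero_le_one hΓc hΓ0 hΓ1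
  refine ⟨ω, walkFlux_eq_zero_of_not_adj_sep h ω fun d hd => ?_, fun Q hQ => ?_⟩
  · -- each step crosses a non-edge
    obtain ⟨t, -, ht⟩ := hωd d hd
    rw [sepHi_eq_sepLo_add]
    set x := Γ.extend t with hx
    have hxseg : x ∈ segment ℝ (meshPoint δ (sepLo d.toProd.1 d.toProd.2))
        (meshPoint δ (sepLo d.toProd.1 d.toProd.2 + Pi.single (if d.toProd.1 0 = d.toProd.2 0 then 0 else 1) 1)) := by
      rw [← sepHi_eq_sepLo_add]; exact ht
    rcases hΓrange t with h1 | h2 | h3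
    · exact hend₁ _ _ x hxseg ((dist_le_of_mem_segment_left h1).trans_lt hfe₁)
    · obtain ⟨s, hs⟩ := h2
      refine not_adj_of_mem_segment_of_not_mem_closure hxseg ?_
      show Γ.extend t ∉ closure Ω
      rw [← hs]; exact (hγmem s).1
    · refine hend₂ _ _ x hxseg ?_
      rw [segment_symm] at h3
      exact (dist_le_of_mem_segment_left h3).trans_lt hfe₂
  · -- every square has a point in `S` or near `qa`, `qb`
    obtain ⟨t, -, ht⟩ := hωs Q hQ
    refine ⟨_, ht, ?_⟩
    rcases hΓrange t with h1 | h2 | h3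
    · have := dist_le_of_mem_segment_left h1
      refine Or.inr (Or.inl ?_)
      calc dist (Γ.extend t) qa ≤ dist (Γ.extend t) f₁ + dist f₁ qa := dist_triangle _ _ _
        _ < η₁ + (r + 2 * δ) := by rw [_root_.dist_comm]; linarith
        _ ≤ r + 3 * δ := by linarith
    · obtain ⟨s, hs⟩ := h2
      rw [← hs]
      exact Or.inl (hγmem s).2
    · rw [segment_symm] at h3
      have := dist_le_of_mem_segment_left h3
      refine Or.inr (Or.inr ?_)
      calc dist (Γ.extend t) qb ≤ dist (Γ.extend t) f₂ + dist f₂ qb := dist_triangle _ _ _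
        _ < η₂ + (r + 2 * δ) := by rw [_root_.dist_comm]; linarith [_root_.dist_comm f₂ e₂]
        _ ≤ r + 3 * δ := by linarith

end KirchhoffSlope

end Summit.CriticalPhenomena.CardyFormulaZ2.Theorems
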